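import Mathlib
import HarnessLib
import Literature.MathematicalPhysics.QuantumLattice.SalmhoferCutoffGevrey
import Summits.HubbardSuperconductivity.HubbardSuperconductivity.Theorems.KLProgrammeKLRegimeEngineFrameShiftResponseFourLegShell
import Summits.HubbardSuperconductivity.HubbardSuperconductivity.Theorems.KLProgrammeKLRegimeEnginePairTransferOutClassFrameShiftOrders
import Summits.HubbardSuperconductivity.HubbardSuperconductivity.Theorems.KLProgrammeKLRegimeCountertermJacksonRemainderReadResidueC1

/-!
# Route `KLProgramme` — ENGINE item stmt-HubbardSuperconductivity-20437 `KLRegimeEngineV17F2`, stub (c) value lane: the `hshift` binder FROM FIVE SIZES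
# (located risk #6 «(c)-HSHIFT-4LEG» CLOSED on the p2 side modulo E1's named sizes; cell gate-hubbard-kl, seat p2 g24)

WHAT.  The end-to-end composition of the p2 door chain for the (c) closer's binder
`hshift : ‖𝒞ₙ[Kₙ](Qm,x,y) − 𝒞ₙ[Kₙ₋₁](Qm,x,y)‖ ≤ frameShiftBar P Q U n` (`1 ≤ n`, history `HistP klPredsV17F2 … 0 n`, `0 < U ≤ klEngU₀4 P R c`, any raise `Q` of
`klEngQ8 P R`): **`hshift_of_sizes`**.  Inputs beyond the history and the stub binders: the two partition-function facts of the scale-`n` mismatch path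
(`Z(Kₙ) ≠ 0` undressed; `Z_t ≠ 0` along `normalCovariance(Ψ_{Kₙ₋₁} + t(Ψ̃ − Ψ_{Kₙ₋₁}))`, vertex `V_U + 𝒩_{Kₙ₋₁}`) and FIVE SIZES in fixed currency
(`c := βL²`, `Λ := Λ_n = klScale klE0 n`, `X` the pair string of `(Qm, x, y)`):
* `A₄`: `‖𝒞ₙ[Kₙ](Qm,x,y)‖ ≤ a·Klam·|U|` (the dressed pair amplitude itself; FIRST-order share, `a ≤ 2²⁸`);
* `N₆`: `‖𝒲_{t,6}(X, Ā, A)‖ ≤ n₆·(Klam·U)²/Λ/(720·c⁵)` for all `t`, `A` (six-leg, flat sup in kernel units = `n₆(KlamU)²/Λ` in vertexFn units — its natural size, k3c3-p1 g15);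
* `S`: `‖𝒲_{t,2}(X̄_i, X_i)‖ ≤ s₂·|U|·Λ/(2c)` for all `t` and ONLY the legs `i` on the band shell `|e_{Kₙ₋₁}(k⃗_i)| < 5Λ/4` (on-shell two-leg = `s₂·U·Λ` in `selfEnergy` units);
* `N₄`: `‖𝒲_{t,4}(X)‖ ≤ n₄·Klam·|U|/(24c³)` for all `t` (four-leg along the path = `n₄·Klam·U` in vertexFn units);
* GEOMETRY: the band-shell count `#{k⃗ : |e_{Kₙ₋₁}(k⃗)| < 5Λ/4} ≤ C_b·L²·Λ` and `π ≤ Λ·β` (the scale is above the lowest Matsubara frequency);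
and ONE numeral inequality with room: `547400·((8/π)·C_b·n₆ + 4·s₂·n₄) ≤ klHshiftC = 2⁹⁶` (`547400 = 200 + 200·2736`, `B₁ = 2736` by
`abs_deriv_salmhoferCutoff_le_numeral`).  Assembly: `frameDist Kₙ Kₙ₋₁ ≤ Λ/4` from the history jets + `Gfr₀U ≤ 2⁻¹²⁷` (§1); the support-resolved ℓ¹ rate
`σ₁ = #{|ω|<Λ ∧ |e|<5Λ/4}·c·547400/Λ² ≤ (8/π)·547400·C_b·c²`; `norm_klPairAmplitude_frame_sub_le_priced₁_shell`; `hshift_of_frameResponse_orders_hist` with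
`cℓ₁ := (6075/2)·a ≤ 2⁴⁰` (U-free door `hshift_door_order1_of_le`) and `cℓ₂ := klHshiftC` (door `hshift_door_order2_klHshiftC_of_le_klEngU₀4`, never binding).
So located risk #6 is CLOSED on the p2 side: what the (c) closer owes for `hshift` is exactly the two `Z` facts + the five sizes + the band count (E1 / fs geometry).
Composition + real arithmetic; no definitions; nothing about the sizes is asserted; nothing here asserts (c), any stub of 20437, K3, the margin or superconductivity.
References: BGM 2006 §2.2–2.3 (2.21)–(2.28), §3 (3.3) [cite: BenfattoGiulianiMastropietro2006].
-/

noncomputable section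

namespace Summit.HubbardSuperconductivity.HubbardSuperconductivity.Theorems.KLRegimeSplit

set_option linter.dupNamespace false -- summit = problem name (single-conjunct summit), D-0017

open Real Finset Literature.MathematicalPhysics.QuantumLattice Literature.Probability.LatticeModels GrassmannAlgebra
open Summit.HubbardSuperconductivity.HubbardSuperconductivity.Theorems.KLProgrammeLegKernels
open Summit.HubbardSuperconductivity.HubbardSuperconductivity.Theorems.EngineV8
open Summit.HubbardSuperconductivity.HubbardSuperconductivity.Theorems.TwoVolumeDefect
open Summit.HubbardSuperconductivity.HubbardSuperconductivity.Theorems.TwoPointAssembly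

section Model

variable {L M : ℕ} [NeZero L] [NeZero M] {G : GeoConsts} {P : SplitConsts} {Q : EngConsts} {R : RenConsts} {β U μ c : ℝ} {n : ℕ}

/-! ## §1 The frame step is inside the resummation radius: `frameDist Kₙ Kₙ₋₁ ≤ Λₙ/4` -/

/-- `Λₙ₊₁ = (32·4ⁿ⁺¹)⁻¹`. -/
theorem klScale_succ_eq_inv (m : ℕ) : klScale klE0 (m + 1) = (32 * (4 : ℝ) ^ (m + 1))⁻¹ := by
  rw [← inv_klScale_succ_eq, inv_inv]

/-- **`frameDist Kₙ Kₙ₋₁ ≤ Λₙ/4`** from the history's (I-F) jets (`frameDist ≤ Gfr₀·|U|·4^{−2(n−1)}`) and `Gfr₀·U ≤ 2⁻¹²⁷` (`U ≤ klEngU₀4`). -/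
theorem frameDist_klFlowFrameU_le_klScale_div_four (hhist : HistP klPredsV17F2 L M G P Q R β U μ 0 n) (hn1 : 1 ≤ n) (hRW : R.WF)
    (hU : 0 < U) (hU4 : U ≤ klEngU₀4 P R c) :
    frameDist (klFlowFrameU L M β U μ n) (klFlowFrameU L M β U μ (n - 1)) ≤ klScale klE0 n / 4 := by
  obtain ⟨m, rfl⟩ : ∃ m, n = m + 1 := ⟨n - 1, by omega⟩
  have hh := (histP_klPredsV17F2_iff L M G P Q R β U μ 0 (m + 1)).1 hhist
  have hJ : ∀ k < m + 1, FlowPieceJetsAt L M β U μ R k := fun k hk => ((hh k hk).2.1).2.1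
  have hdist := frameDist_klFlowFrameU_succ_le (L := L) (M := M) (β := β) (U := U) (μ := μ) (R := R) (j := m) hJ
  rw [zpow_jets_zero] at hdist
  have hu : uPow 0 U = |U| := by simp [uPow]
  rw [hu, abs_of_pos hU] at hdist
  rw [show m + 1 - 1 = m by omega, klScale_succ_eq_inv]
  have hGU : R.Gfr 0 * U ≤ 1 / 2 ^ 127 := gfr_mul_le_of_le_klEngU₀4 (P := P) hRW hU4 (by norm_num)
  have hG0 : 0 ≤ R.Gfr 0 := hRW.2.2 0
  have h4 : (1 : ℝ) ≤ 4 ^ m := one_le_pow₀ (by norm_num)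
  have h4pos : (0 : ℝ) < 4 ^ m := by positivity
  have hinv1 : ((4 : ℝ) ^ m)⁻¹ ≤ 1 := inv_le_one_of_one_le₀ h4
  calc frameDist (klFlowFrameU L M β U μ (m + 1)) (klFlowFrameU L M β U μ m)
      ≤ R.Gfr 0 * U * (((4 : ℝ) ^ m)⁻¹ * ((4 : ℝ) ^ m)⁻¹) := hdist
    _ ≤ 1 / 2 ^ 127 * (((4 : ℝ) ^ m)⁻¹ * 1) := by gcongr
    _ = ((4 : ℝ) ^ m)⁻¹ * (1 / 2 ^ 127) := by ring
    _ ≤ ((4 : ℝ) ^ m)⁻¹ * (1 / 512) := mul_le_mul_of_nonneg_left (by norm_num) (by positivity)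
    _ = (32 * (4 : ℝ) ^ (m + 1))⁻¹ / 4 := by rw [pow_succ]; field_simp; ring

/-! ## §2 `hshift` from the five sizes -/
set_option maxHeartbeats 400000 in
/-- **THE `hshift` BINDER FROM FIVE SIZES** (module docstring): history + stub binders + the two partition-function facts of the scale-`n` mismatch path + the
sizes `A₄ = a·Klam·|U|` (pair amplitude), `N₆ = n₆(KlamU)²/Λₙ/(720c⁵)` (six-leg), `S = s₂·|U|·Λₙ/(2c)` ON-SHELL (two-leg), `N₄ = n₄·Klam·|U|/(24c³)` (four-leg),
the band-shell count `≤ C_b·L²·Λₙ`, `π ≤ Λₙβ`, and the room inequality `547400·((8/π)·C_b·n₆ + 4·s₂·n₄) ≤ klHshiftC`, `a ≤ 2²⁸`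
⟹ `‖𝒞ₙ[Kₙ](Qm,x,y) − 𝒞ₙ[Kₙ₋₁](Qm,x,y)‖ ≤ frameShiftBar P Q U n`. [cite: BenfattoGiulianiMastropietro2006, §2.3 (2.21)–(2.24), §3 (3.3)] -/
theorem hshift_of_sizes (hhist : HistP klPredsV17F2 L M G P Q R β U μ 0 n) (hn1 : 1 ≤ n) (hP : P.WF) (hRW : R.WF)
    (hQ : (klEngQ8 P R).IsRaiseOf Q) (hU : 0 < U) (hU4 : U ≤ klEngU₀4 P R c) (hβ : 0 < β) {Qm x y : TorusSite 2 L}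
    (hZ₂ : effPartitionFn ℂ (normalCovariance L M (uvSymbolCT L M β μ (klFlowFrameU L M β U μ n) (klScale klE0 n)))
      (hubbardInteraction L M β U + counterQuadratic L M β (klFlowFrameU L M β U μ n)) ≠ 0)
    {s₀ s₁ : FreqMomentum L M × Fin 2 → ℂ} (hs₀ : s₀ = uvSymbolCT L M β μ (klFlowFrameU L M β U μ (n - 1)) (klScale klE0 n))
    (hs₁ : s₁ = fun ks => uvSymbolCT L M β μ (klFlowFrameU L M β U μ n) (klScale klE0 n) ks /
      (1 + uvSymbolCT L M β μ (klFlowFrameU L M β U μ n) (klScale klE0 n) ks *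
        (((fsub (klFlowFrameU L M β U μ n) (klFlowFrameU L M β U μ (n - 1))).eval (latticeMomentum L ks.1.2) / (β * (L : ℝ) ^ 2) : ℝ) : ℂ)))
    (hZ : ∀ t ∈ Set.Icc (0 : ℝ) 1, effPartitionFn ℂ (normalCovariance L M s₀ + ((t : ℂ)) • (normalCovariance L M s₁ - normalCovariance L M s₀))
      (hubbardInteraction L M β U + counterQuadratic L M β (klFlowFrameU L M β U μ (n - 1))) ≠ 0)
    {a n₆ s₂ n₄ Cb : ℝ} (ha0 : 0 ≤ a) (ha : a ≤ 2 ^ 28) (hn₆ : 0 ≤ n₆) (hs₂ : 0 ≤ s₂) (hn₄ : 0 ≤ n₄)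
    (hroom : 547400 * (8 / Real.pi * Cb * n₆ + 4 * s₂ * n₄) ≤ klHshiftC)
    (hC4 : ‖klPairAmplitude L M β U μ (klFlowFrameU L M β U μ n) n Qm x y‖ ≤ a * (P.Klam * |U|))
    (hN6 : ∀ t ∈ Set.Icc (0 : ℝ) 1, ∀ A : HubbardFieldIdx L M,
      ‖kernel ℂ (effAction ℂ (normalCovariance L M s₀ + ((t : ℂ)) • (normalCovariance L M s₁ - normalCovariance L M s₀))
        (hubbardInteraction L M β U + counterQuadratic L M β (klFlowFrameU L M β U μ (n - 1)))) 6
        (Fin.snoc (Fin.snoc ![(((omega0 M, y), 0), 0), ((((omega0 M).rev, Qm - y), 1), 0), ((((omega0 M).rev, Qm - x), 1), 1), (((omega0 M, x), 0), 1)] (A.1, 1 - A.2) : Fin 5 → HubbardFieldIdx L M) A)‖ ≤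
          n₆ * (P.Klam * U) ^ 2 / klScale klE0 n / (720 * (β * (L : ℝ) ^ 2) ^ 5))
    (hS : ∀ t ∈ Set.Icc (0 : ℝ) 1, ∀ i : Fin 4,
      |nambuXiCT L μ (klFlowFrameU L M β U μ (n - 1)) ((![(((omega0 M, y), 0), 0), ((((omega0 M).rev, Qm - y), 1), 0), ((((omega0 M).rev, Qm - x), 1), 1), (((omega0 M, x), 0), 1)] :
              Fin 4 → HubbardFieldIdx L M) i).1.1.2| < 5 * klScale klE0 n / 4 →
      ‖kernel ℂ (effAction ℂ (normalCovariance L M s₀ + ((t : ℂ)) • (normalCovariance L M s₁ - normalCovariance L M s₀))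
        (hubbardInteraction L M β U + counterQuadratic L M β (klFlowFrameU L M β U μ (n - 1)))) 2
        ![((((![(((omega0 M, y), 0), 0), ((((omega0 M).rev, Qm - y), 1), 0), ((((omega0 M).rev, Qm - x), 1), 1), (((omega0 M, x), 0), 1)] :
              Fin 4 → HubbardFieldIdx L M) i).1,
            1 - ((![(((omega0 M, y), 0), 0), ((((omega0 M).rev, Qm - y), 1), 0), ((((omega0 M).rev, Qm - x), 1), 1), (((omega0 M, x), 0), 1)] :
              Fin 4 → HubbardFieldIdx L M) i).2) : HubbardFieldIdx L M),
          (![(((omega0 M, y), 0), 0), ((((omega0 M).rev, Qm - y), 1), 0), ((((omega0 M).rev, Qm - x), 1), 1), (((omega0 M, x), 0), 1)] :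
              Fin 4 → HubbardFieldIdx L M) i]‖ ≤ s₂ * |U| * klScale klE0 n / (2 * (β * (L : ℝ) ^ 2)))
    (hN4 : ∀ t ∈ Set.Icc (0 : ℝ) 1,
      ‖kernel ℂ (effAction ℂ (normalCovariance L M s₀ + ((t : ℂ)) • (normalCovariance L M s₁ - normalCovariance L M s₀))
        (hubbardInteraction L M β U + counterQuadratic L M β (klFlowFrameU L M β U μ (n - 1)))) 4
        ![(((omega0 M, y), 0), 0), ((((omega0 M).rev, Qm - y), 1), 0), ((((omega0 M).rev, Qm - x), 1), 1), (((omega0 M, x), 0), 1)]‖ ≤ n₄ * (P.Klam * |U|) / (24 * (β * (L : ℝ) ^ 2) ^ 3))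
    (hband : (((Finset.univ.filter fun kv : TorusSite 2 L => |nambuXiCT L μ (klFlowFrameU L M β U μ (n - 1)) kv| < 5 * klScale klE0 n / 4).card : ℕ) : ℝ) ≤
      Cb * (L : ℝ) ^ 2 * klScale klE0 n)
    (hΛβ : Real.pi ≤ klScale klE0 n * β) :
    ‖klPairAmplitude L M β U μ (klFlowFrameU L M β U μ n) n Qm x y - klPairAmplitude L M β U μ (klFlowFrameU L M β U μ (n - 1)) n Qm x y‖ ≤ frameShiftBar P Q U n := by
  have hΛ : 0 < klScale klE0 n := klth_klScale_pos n
  have hL : (0 : ℝ) < L := by exact_mod_cast NeZero.pos L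
  have hc : 0 < β * (L : ℝ) ^ 2 := by positivity
  have hKlam : 1 ≤ P.Klam := hP.1
  have hB0 : (0 : ℝ) ≤ 2736 := by norm_num
  have hB : ∀ y, |deriv salmhoferCutoff y| ≤ 2736 := abs_deriv_salmhoferCutoff_le_numeral
  set Λ := klScale klE0 n with hΛdef
  set cc := β * (L : ℝ) ^ 2 with hccdef
  -- §1: inside the resummation radius
  have hfd := frameDist_klFlowFrameU_le_klScale_div_four hhist hn1 hRW hU hU4
  have hfd0 : 0 ≤ frameDist (klFlowFrameU L M β U μ n) (klFlowFrameU L M β U μ (n - 1)) := frameDist_nonneg _ _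
  -- the support-resolved ℓ¹ rate
  have hDk : ∀ kv : TorusSite 2 L, |(fsub (klFlowFrameU L M β U μ n) (klFlowFrameU L M β U μ (n - 1))).eval (latticeMomentum L kv)| ≤ frameDist (klFlowFrameU L M β U μ n) (klFlowFrameU L M β U μ (n - 1)) := fun kv => by
    rw [eval_fsub]; exact abs_eval_sub_le_frameDist _ _ _
  set Nsupp : ℝ := (((Finset.univ.filter fun ks : FreqMomentum L M × Fin 2 =>
      |matsubaraFreq β M ks.1.1| < Λ ∧ |nambuXiCT L μ (klFlowFrameU L M β U μ (n - 1)) ks.1.2| < 5 * Λ / 4).card : ℕ) : ℝ) with hNsupp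
  have hσ : ∑ p, ‖s₁ p - s₀ p‖ ≤ (Nsupp * (cc * (200 + 200 * 2736) / Λ ^ 2)) * frameDist (klFlowFrameU L M β U μ n) (klFlowFrameU L M β U μ (n - 1)) := by
    subst hs₀ hs₁
    have h := sum_norm_mismatchDefect_le_support (M := M) hβ μ (klFlowFrameU L M β U μ (n - 1)) (klFlowFrameU L M β U μ n) hΛ hB0 hB hfd hDk
    rw [← mul_assoc] at h
    exact h
  -- the frame response, every share priced
  have hresp := norm_klPairAmplitude_frame_sub_le_priced₁_shell (L := L) (M := M) hβ hB0 hB U μ (klFlowFrameU L M β U μ (n - 1)) (klFlowFrameU L M β U μ n) n hfd hZ₂ hs₀ hs₁ hσ Qm x y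
    hC4 hZ hN6 hS hN4 (by positivity)
  -- the support count: `Nsupp ≤ (8/π)·Cb·c·Λ²`
  have hsupp : Nsupp ≤ 8 / Real.pi * Cb * cc * Λ ^ 2 := by
    have h1 := card_freqBand_le (L := L) (M := M) (β := β) hβ μ (klFlowFrameU L M β U μ (n - 1)) (Λ := Λ) hΛ.le
    have h3 : Λ * β / Real.pi + 3 ≤ 4 * (Λ * β / Real.pi) := by
      have : 1 ≤ Λ * β / Real.pi := by rw [le_div_iff₀ Real.pi_pos]; linarith
      linarith
    have hb0 : 0 ≤ (((Finset.univ.filter fun kv : TorusSite 2 L => |nambuXiCT L μ (klFlowFrameU L M β U μ (n - 1)) kv| < 5 * Λ / 4).card : ℕ) : ℝ) := by positivity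
    calc Nsupp ≤ 2 * (Λ * β / Real.pi + 3) *
          (((Finset.univ.filter fun kv : TorusSite 2 L => |nambuXiCT L μ (klFlowFrameU L M β U μ (n - 1)) kv| < 5 * Λ / 4).card : ℕ) : ℝ) := h1
      _ ≤ 2 * (4 * (Λ * β / Real.pi)) * (Cb * (L : ℝ) ^ 2 * Λ) := by gcongr
      _ = 8 / Real.pi * Cb * cc * Λ ^ 2 := by rw [hccdef]; ring
  -- the second-order share
  have hKU2 : 0 ≤ (P.Klam * U) ^ 2 := sq_nonneg _
  have hloop : 24 * (|β| * (L : ℝ) ^ 2) ^ 3 * (30 * (Nsupp * (cc * (200 + 200 * 2736) / Λ ^ 2)) *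
      (n₆ * (P.Klam * U) ^ 2 / Λ / (720 * (β * (L : ℝ) ^ 2) ^ 5))) ≤ 547400 * (8 / Real.pi * Cb * n₆) * ((P.Klam * U) ^ 2 / Λ) := by
    rw [abs_of_pos hβ, ← hccdef]
    have e : 24 * cc ^ 3 * (30 * (Nsupp * (cc * (200 + 200 * 2736) / Λ ^ 2)) * (n₆ * (P.Klam * U) ^ 2 / Λ / (720 * cc ^ 5))) =
        Nsupp * (547400 * n₆ * ((P.Klam * U) ^ 2 / Λ) / (cc * Λ ^ 2)) := by
      field_simp
      ring
    rw [e]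
    calc Nsupp * (547400 * n₆ * ((P.Klam * U) ^ 2 / Λ) / (cc * Λ ^ 2))
        ≤ (8 / Real.pi * Cb * cc * Λ ^ 2) * (547400 * n₆ * ((P.Klam * U) ^ 2 / Λ) / (cc * Λ ^ 2)) :=
          mul_le_mul_of_nonneg_right hsupp (by positivity)
      _ = 547400 * (8 / Real.pi * Cb * n₆) * ((P.Klam * U) ^ 2 / Λ) := by field_simp
  have htree : 24 * (|β| * (L : ℝ) ^ 2) ^ 3 * (8 * (β * (L : ℝ) ^ 2 * (200 + 200 * 2736) / Λ ^ 2) *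
      (s₂ * |U| * Λ / (2 * (β * (L : ℝ) ^ 2))) * (n₄ * (P.Klam * |U|) / (24 * (β * (L : ℝ) ^ 2) ^ 3))) ≤
      547400 * (4 * s₂ * n₄) * ((P.Klam * U) ^ 2 / Λ) := by
    rw [abs_of_pos hβ, abs_of_pos hU, ← hccdef]
    have e : 24 * cc ^ 3 * (8 * (cc * (200 + 200 * 2736) / Λ ^ 2) * (s₂ * U * Λ / (2 * cc)) * (n₄ * (P.Klam * U) / (24 * cc ^ 3))) =
        547400 * (4 * s₂ * n₄) * (P.Klam * U ^ 2 / Λ) := by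
      field_simp
      ring
    rw [e]
    have hK : P.Klam * U ^ 2 / Λ ≤ (P.Klam * U) ^ 2 / Λ := by
      rw [div_le_div_iff_of_pos_right hΛ]
      have hU2 : 0 ≤ U ^ 2 := sq_nonneg U
      nlinarith [mul_nonneg (sub_nonneg.2 hKlam) (mul_nonneg (zero_le_one.trans hKlam) hU2)]
    exact mul_le_mul_of_nonneg_left hK (by positivity)
  have hℓ₂ : 24 * (|β| * (L : ℝ) ^ 2) ^ 3 * (30 * (Nsupp * (cc * (200 + 200 * 2736) / Λ ^ 2)) *
        (n₆ * (P.Klam * U) ^ 2 / Λ / (720 * (β * (L : ℝ) ^ 2) ^ 5)) +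
      8 * (β * (L : ℝ) ^ 2 * (200 + 200 * 2736) / Λ ^ 2) * (s₂ * |U| * Λ / (2 * (β * (L : ℝ) ^ 2))) *
        (n₄ * (P.Klam * |U|) / (24 * (β * (L : ℝ) ^ 2) ^ 3))) ≤ klHshiftC * (P.Klam * U) ^ 2 / Λ := by
    rw [mul_add]
    refine (add_le_add hloop htree).trans ?_
    rw [← add_mul, ← mul_add, mul_div_assoc]
    exact mul_le_mul_of_nonneg_right hroom (by positivity)
  -- the first-order share
  have hℓ₁ : 6075 / 2 * (a * (P.Klam * |U|)) / Λ ≤ 6075 / 2 * a * (P.Klam * |U|) / Λ := by rw [mul_assoc]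
  have hcℓ₁ : 6075 / 2 * a ≤ 2 ^ 40 := by nlinarith
  exact hshift_of_frameResponse_orders_hist hhist hn1 (hRW.2.2 0) (zero_le_one.trans hKlam) (by positivity) klHshiftC_nonneg hresp hℓ₁ hℓ₂
    (hshift_door_order1_of_le hP hRW hQ hcℓ₁) (hshift_door_order2_klHshiftC_of_le_klEngU₀4 hRW hQ hU hU4)

end Model

end Summit.HubbardSuperconductivity.HubbardSuperconductivity.Theorems.KLRegimeSplit

end
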